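import Summits.ResolutionOfSingularities.ResolutionOfSingularities.Theorems.FrobeniusClosingPatchingRelPerfectTwoPlanesPlaneJq
import Summits.ResolutionOfSingularities.ResolutionOfSingularities.Theorems.FrobeniusClosingPatchingRelPerfectTwoPlanesChartTwoJqIdeals
import HarnessLib

/-!
# Crux `PatchingRelPerfect` (stmt-ResolutionOfSingularities-16161), chain w52 — the rank-two member
# `f = x₀x₁ + x₂³`: the chart `B₂` is RESOLVED by the REPAIRED companion `𝔪ᴺ·A·J_q·A₃·A₄` (unconditional)

[OURS · L1 W5.2 · rung] `…TwoPlanesChartTwoJqIdeals.map_tpAllJq_two` + `…TwoPlanesPlaneJq.isRegular_of_isBlowup_tpPlane_coreJq_two`: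
every blowing up of `Spec B₂` along `(𝔪ᴺ · A · J_q · A₃ · A₄ · I) B₂` is regular.  This is the `B₂` input of the
final rung `atomConclusion_of_pointBlowup_charts` for the repaired companion (design note NEXT-two-planes-cube.md,
Addenda 9–10); `B₀` is `…TwoPlanesSideZero` (up to one more power of `u`), `B₁` and `B₃` remain.

* `isRegular_of_isBlowup_tpAllJq_two`.

Nothing here is a statement of the manuscript under review.

## References

* The Stacks Project, Tags 080A, 080B. [StacksProject]
-/

-- `Summit.<Summit>.<Sub>.Theorems` with `Sub = Summit` (single-conjunct summit, D-0017)
set_option linter.dupNamespace false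

noncomputable section

open CategoryTheory CategoryTheory.Limits AlgebraicGeometry Literature.AlgebraicGeometry.Resolution
open IsLocalRing

namespace Summit.ResolutionOfSingularities.ResolutionOfSingularities.Theorems

namespace TwoPlanesRung

open ConeRung

universe u

section ChartTwoJq

variable {S : Type u} [CommRing S] [IsRegularLocalRing S] (x : Fin 4 → S)
  (hx : Ideal.span (Set.range x) = IsLocalRing.maximalIdeal S)
  (hd : (IsLocalRing.maximalIdeal S).spanFinrank = 4)

local notation3 (prettyPrint := false) "M" => Ideal.span (Set.range x)
local notation3 (prettyPrint := false) "fT" => x 0 * x 1 + x 2 ^ 3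
local notation3 (prettyPrint := false) "φ" => chartBase x 2
local notation3 (prettyPrint := false) "uB" => chartBase x 2 (x 2)
local notation3 (prettyPrint := false) "e[" j "]" => chartGen x 2 j
local notation3 (prettyPrint := false) "U" => Ideal.span {chartBase x 2 (x 2)}
local notation3 (prettyPrint := false) "II" => Ideal.span (Set.range
  (Fin.cons (chartBase x 2 (x 2)) (fun _ : Fin 1 => chartGen x 2 0) : Fin 2 → chartRing x 2))
local notation3 (prettyPrint := false) "J" => Ideal.span {chartGen x 2 0 * chartGen x 2 1, chartBase x 2 (x 2)} *
    (Ideal.span {chartGen x 2 0 * chartGen x 2 1 + chartBase x 2 (x 2) * chartGen x 2 2 ^ 3} ⊔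
      Ideal.span {chartBase x 2 (x 2)} * Ideal.span {chartGen x 2 0} ⊔ Ideal.span {chartBase x 2 (x 2)} ^ 2) *
    (Ideal.span {chartGen x 2 0 * chartGen x 2 1 + chartBase x 2 (x 2) * chartGen x 2 2 ^ 3} ⊔
      Ideal.span {chartBase x 2 (x 2)} ^ 2)
local notation3 (prettyPrint := false) "tpJq" => Ideal.span {x 0} ⊔ Ideal.span {x 1, x 2} * Ideal.span {x 1, x 2, x 3} ⊔
  Ideal.span {x 3 ^ 3}

include hx hd in
/-- **The chart `B₂` of the rank-two member is resolved by the repaired companion** (unconditional).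
[cite: StacksProject, Tag 080A] [cite: StacksProject, Tag 080B] -/
theorem isRegular_of_isBlowup_tpAllJq_two (N : ℕ) {Y : Scheme.{u}} {ρ : Y ⟶ Spec (.of (chartRing x 2))}
    (hρ : IsBlowup ρ (affineBlowup.idealSheaf
      ((M ^ N * (Ideal.span {fT} ⊔ Ideal.span {x 0} * M ⊔ M ^ 3) * tpJq * (Ideal.span {fT} ⊔ M ^ 3) *
        (Ideal.span {fT} ⊔ Ideal.span {x 0} * M ^ 2 ⊔ M ^ 4) * (Ideal.span {fT} ⊔ M ^ 4)).map φ))) :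
    Scheme.IsRegular Y := by
  rw [map_tpAllJq_two] at hρ
  exact isRegular_of_isBlowup_tpPlane_coreJq_two x hx hd 2 rfl (N + 9) hρ

end ChartTwoJq

end TwoPlanesRung

end Summit.ResolutionOfSingularities.ResolutionOfSingularities.Theorems

end
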